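import Mathlib
import Summits.NavierStokesRegularity.NavierStokesRegularity.Theorems.EulerZoomLiouvillePowerGaugeEulerLiouvilleCondenserPythagoras

/-!
# (M2) RADIAL ENERGY OF A CIRCULAR MEAN, (M3a/b) FIRST AND SECOND FOURIER MODES BY PARTS, (M3c) SUP-POINCARÉ ON THE
CIRCLE — plates t50-S of nsreg-p2 ROUND-47 «WHO HOLDS THE RIDGE» (`r47/Sketch47.lean` sha16 c5b0bf755040b563, texts
VERBATIM)

Width piece for crux `EulerZoomLiouville.PowerGaugeEulerLiouville` (stmt-NavierStokesRegularity-19832), by name under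
LEAD 19832 (successor of ns-typeII-p2 g13) and planner nsreg-p2 g37; seat ns-ezl-w2 g5,
`--supports stmt-NavierStokesRegularity-19832 --as helper`.

Four of the ten free-standing S lemmas (circle / annulus calculus) that price the holders of the pressure ridge in the
slice radial-momentum identity (ROUND-47 §2):

* `circleMeanRadialEnergy` = `NsregP2.R47.CircleMeanRadialEnergy` (M2): for `ψ ∈ C¹(ℂ,ℝ)`, `0 < δ ≤ d`,
  `∫_δ^d ρ m′(ρ)² dρ ≤ (2π)⁻¹ ∫_{δ ≤ ‖z‖ ≤ d} ‖Dψ‖²` for the circular mean `m(ρ) = ⨍_{‖z‖=ρ} ψ` — immediate from the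
  tree's energy split `annulusEnergy_eq_radial_add_deviation` (t46-G, `…CondenserPythagoras`) and
  `deriv_circleAverage_radius` (`…CondenserCircleMeanDerivative`): the deviation energy is non-negative.
* `firstModeIBP` = `NsregP2.R47.FirstModeIBP` (M3a), `secondModeIBP` = `NsregP2.R47.SecondModeIBP` (M3b): for
  `g ∈ C¹([0,2π]; ℂ)` with `g 0 = g 2π`, `‖∫ g e^{−iθ}‖ ≤ ∫‖g′‖` and `‖∫ g e^{−2iθ}‖ ≤ ½∫‖g′‖` (integration by parts
  against `d(ie^{−iθ}) = e^{−iθ}dθ`, `d(ie^{−2iθ}/2) = e^{−2iθ}dθ`; the boundary terms cancel by periodicity).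
* `circleSupPoincare` = `NsregP2.R47.CircleSupPoincare` (M3c): `‖g θ − ⨍ g‖ ≤ ½∫_0^{2π}‖g′‖` (between two points go
  round the circle the shorter way: `2‖g u − g s‖ ≤ ∫_0^{2π}‖g′‖`; then average in the second point).

HONEST FRAMING: elementary circle / annulus calculus on the MODEL lattice of crux E; proves nothing about the crux
(19832 OPEN), about `Sig.stub_selfSimilarC2Needle`, about THEOREM K⁗, or about Navier–Stokes regularity; no hard core
is touched. [folklore]
-/

noncomputable section

open Set Filter Topology Metric Function MeasureTheory Real
open scoped Interval

set_option linter.dupNamespace false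

namespace Summit.NavierStokesRegularity.NavierStokesRegularity.Theorems.PowerGaugeEulerLiouville.Condenser

/-! ## (M2) Radial energy of a circular mean -/

/-- **(M2) RADIAL ENERGY OF A CIRCULAR MEAN**, working form: for `ψ ∈ C¹(ℂ,ℝ)`, `0 < δ ≤ d`, with
`m(ρ) = ⨍_{‖z‖=ρ} ψ`: `∫_δ^d ρ·m′(ρ)² dρ ≤ (2π)⁻¹ ∫_{δ≤‖z‖≤d} ‖Dψ‖²` (the energy split of t46-G: total energy =
`2π∫ρ m′² +` the non-negative deviation energy). [folklore] -/
theorem circleMeanRadialEnergy_of {ψ : ℂ → ℝ} (hψ : ContDiff ℝ 1 ψ) {δ d : ℝ} (hδ : 0 < δ) (hδd : δ ≤ d) :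
    ∫ ρ in δ..d, ρ * deriv (fun r : ℝ => Real.circleAverage ψ 0 r) ρ ^ 2 ≤
      (2 * Real.pi)⁻¹ * (∫ z in {z : ℂ | δ ≤ ‖z‖ ∧ ‖z‖ ≤ d}, ‖fderiv ℝ ψ z‖ ^ 2) := by
  have hsplit := annulusEnergy_eq_radial_add_deviation hψ hδ hδd
  have hderiv : (fun ρ : ℝ => ρ * deriv (fun r : ℝ => Real.circleAverage ψ 0 r) ρ ^ 2) = fun ρ : ℝ =>
      ρ * ((2 * π)⁻¹ * ∫ θ in (0 : ℝ)..2 * π, fderiv ℝ ψ (circleMap 0 ρ θ) (circleMap 0 1 θ)) ^ 2 := by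
    funext ρ; rw [deriv_circleAverage_radius hψ ρ]
  have hdev : 0 ≤ ∫ z in {z : ℂ | δ ≤ ‖z‖ ∧ ‖z‖ ≤ d},
      ‖fderiv ℝ (fun z => ψ z - Real.circleAverage ψ 0 ‖z‖) z‖ ^ 2 :=
    setIntegral_nonneg (measurableSet_annulus δ d) fun z _ => sq_nonneg _
  have hπ : 0 < 2 * π := by positivity
  rw [hderiv, hsplit, mul_add, ← mul_assoc, inv_mul_cancel₀ hπ.ne', one_mul]
  linarith [mul_nonneg (inv_nonneg.2 hπ.le) hdev]

/-- **(M2) `NsregP2.R47.CircleMeanRadialEnergy`, binder-for-binder** (Sketch47 of nsreg-p2 g37, plate t50-M2).  In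
the log variable `t = log ρ` this reads `∫|dm/dt|² dt ≤ (2π)⁻¹ × (annulus energy)` — the input of (M4a)/(M4b) for the
radial means of `V_⊥` and `V_e`. [folklore] -/
theorem circleMeanRadialEnergy :
    ∀ (ψ : ℂ → ℝ), ContDiff ℝ 1 ψ → ∀ (δ d : ℝ), 0 < δ → δ ≤ d →
      ∫ ρ in δ..d, ρ * deriv (fun r : ℝ => Real.circleAverage ψ 0 r) ρ ^ 2 ≤
        (2 * Real.pi)⁻¹ * (∫ z in {z : ℂ | δ ≤ ‖z‖ ∧ ‖z‖ ≤ d}, ‖fderiv ℝ ψ z‖ ^ 2) :=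
  fun _ hψ _ _ hδ hδd => circleMeanRadialEnergy_of hψ hδ hδd

/-! ## (M3a), (M3b) The first two Fourier modes by parts -/

/-- `d/dθ (i e^{−iθ}) = e^{−iθ}`. [folklore] -/
theorem hasDerivAt_I_mul_exp_neg (θ : ℝ) :
    HasDerivAt (fun θ : ℝ => Complex.I * Complex.exp (-((θ : ℂ) * Complex.I)))
      (Complex.exp (-((θ : ℂ) * Complex.I))) θ := by
  have h1 : HasDerivAt (fun θ : ℝ => -((θ : ℂ) * Complex.I)) (-Complex.I) θ := by
    simpa [Pi.neg_def] using ((hasDerivAt_id θ).ofReal_comp.mul_const Complex.I).neg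
  have h3 := ((Complex.hasDerivAt_exp _).comp θ h1).const_mul Complex.I
  refine h3.congr_deriv ?_
  linear_combination (-Complex.exp (-((θ : ℂ) * Complex.I))) * Complex.I_sq

/-- `d/dθ ((i/2) e^{−2iθ}) = e^{−2iθ}`. [folklore] -/
theorem hasDerivAt_I_half_mul_exp_neg_two (θ : ℝ) :
    HasDerivAt (fun θ : ℝ => Complex.I / 2 * Complex.exp (-(2 * (θ : ℂ) * Complex.I)))
      (Complex.exp (-(2 * (θ : ℂ) * Complex.I))) θ := by
  have h1 : HasDerivAt (fun θ : ℝ => -(2 * (θ : ℂ) * Complex.I)) (-(2 * Complex.I)) θ := by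
    simpa [Pi.neg_def] using (((hasDerivAt_id θ).ofReal_comp.const_mul (2 : ℂ)).mul_const Complex.I).neg
  have h3 := ((Complex.hasDerivAt_exp _).comp θ h1).const_mul (Complex.I / 2)
  refine h3.congr_deriv ?_
  linear_combination (-Complex.exp (-(2 * (θ : ℂ) * Complex.I))) * Complex.I_sq

/-- `‖e^{−iθ}‖ = 1`. [folklore] -/
theorem norm_exp_neg_mul_I (θ : ℝ) : ‖Complex.exp (-((θ : ℂ) * Complex.I))‖ = 1 := by
  rw [show -((θ : ℂ) * Complex.I) = ((-θ : ℝ) : ℂ) * Complex.I by push_cast; ring]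
  exact Complex.norm_exp_ofReal_mul_I _

/-- `‖e^{−2iθ}‖ = 1`. [folklore] -/
theorem norm_exp_neg_two_mul_I (θ : ℝ) : ‖Complex.exp (-(2 * (θ : ℂ) * Complex.I))‖ = 1 := by
  rw [show -(2 * (θ : ℂ) * Complex.I) = ((-(2 * θ) : ℝ) : ℂ) * Complex.I by push_cast; ring]
  exact Complex.norm_exp_ofReal_mul_I _

/-- **INTEGRATION BY PARTS AGAINST A UNIMODULAR PHASE** (common core of (M3a), (M3b)): if `v′ = e` on `[0,2π]` with
`v 0 = v 2π`, `‖v θ‖ = c` for all `θ`, and `g ∈ C¹([0,2π]; ℂ)` with `g 0 = g 2π`, then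
`‖∫_0^{2π} g·e‖ ≤ c ∫_0^{2π} ‖g′‖`. [folklore] -/
theorem norm_integral_mul_le_of_periodic_primitive {g g' v e : ℝ → ℂ} {c : ℝ}
    (hg : ∀ θ ∈ Icc 0 (2 * π), HasDerivAt g (g' θ) θ) (hg' : ContinuousOn g' (Icc 0 (2 * π)))
    (hper : g 0 = g (2 * π)) (hv : ∀ θ : ℝ, HasDerivAt v (e θ) θ) (he : Continuous e)
    (hvper : v 0 = v (2 * π)) (hvn : ∀ θ, ‖v θ‖ = c) :
    ‖∫ θ in (0 : ℝ)..2 * π, g θ * e θ‖ ≤ c * ∫ θ in (0 : ℝ)..2 * π, ‖g' θ‖ := by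
  have h2π : (0 : ℝ) ≤ 2 * π := by positivity
  have hI : uIcc 0 (2 * π) = Icc 0 (2 * π) := uIcc_of_le h2π
  have hg'i : IntervalIntegrable g' volume 0 (2 * π) := (hg'.mono hI.le).intervalIntegrable
  have hvc : Continuous v := continuous_iff_continuousAt.2 fun θ => (hv θ).continuousAt
  have hparts := intervalIntegral.integral_mul_deriv_eq_deriv_mul (u := g) (v := v) (u' := g') (v' := e)
    (fun θ hθ => hg θ (hI ▸ hθ)) (fun θ _ => hv θ) hg'i (he.intervalIntegrable _ _)
  have hbdry : g (2 * π) * v (2 * π) - g 0 * v 0 = 0 := by rw [hper, hvper, sub_self]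
  rw [hparts, hbdry, zero_sub, norm_neg]
  calc ‖∫ θ in (0 : ℝ)..2 * π, g' θ * v θ‖ ≤ ∫ θ in (0 : ℝ)..2 * π, ‖g' θ * v θ‖ :=
        intervalIntegral.norm_integral_le_integral_norm h2π
    _ = ∫ θ in (0 : ℝ)..2 * π, c * ‖g' θ‖ :=
        intervalIntegral.integral_congr fun θ _ => by simp only [norm_mul, hvn]; ring
    _ = c * ∫ θ in (0 : ℝ)..2 * π, ‖g' θ‖ := intervalIntegral.integral_const_mul _ _

/-- **(M3a) FIRST FOURIER MODE BY PARTS**, working form: for `g ∈ C¹([0,2π]; ℂ)` with `g 0 = g 2π`,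
`‖∫_0^{2π} g(θ) e^{−iθ} dθ‖ ≤ ∫_0^{2π} ‖g′‖` (`e^{−iθ}dθ = d(ie^{−iθ})`, boundary terms cancel). [folklore] -/
theorem firstModeIBP_of {g g' : ℝ → ℂ} (hg : ∀ θ ∈ Icc 0 (2 * π), HasDerivAt g (g' θ) θ)
    (hg' : ContinuousOn g' (Icc 0 (2 * π))) (hper : g 0 = g (2 * π)) :
    ‖∫ θ in (0 : ℝ)..2 * π, g θ * Complex.exp (-((θ : ℂ) * Complex.I))‖ ≤ ∫ θ in (0 : ℝ)..2 * π, ‖g' θ‖ := by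
  have hvper : Complex.I * Complex.exp (-(((0 : ℝ) : ℂ) * Complex.I)) =
      Complex.I * Complex.exp (-(((2 * π : ℝ) : ℂ) * Complex.I)) := by
    rw [show -(((2 * π : ℝ) : ℂ) * Complex.I) = ((-1 : ℤ) : ℂ) * (2 * π * Complex.I) by push_cast; ring,
      Complex.exp_int_mul_two_pi_mul_I]
    simp
  have hvn : ∀ θ : ℝ, ‖Complex.I * Complex.exp (-((θ : ℂ) * Complex.I))‖ = 1 := fun θ => by
    rw [norm_mul, Complex.norm_I, norm_exp_neg_mul_I, one_mul]
  have he : Continuous fun θ : ℝ => Complex.exp (-((θ : ℂ) * Complex.I)) := by fun_prop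
  have h := norm_integral_mul_le_of_periodic_primitive hg hg' hper hasDerivAt_I_mul_exp_neg he hvper hvn
  rwa [one_mul] at h

/-- **(M3a) `NsregP2.R47.FirstModeIBP`, binder-for-binder** (Sketch47 of nsreg-p2 g37, plate t50-M3a).  Use in
ROUND-47: `∫_θ v_r dθ = Re ∫ g e^{−iθ}` with `g θ = v(ρe^{iθ})`, `g′ = Dv[iρe^{iθ}]`, so `|∫_θ v_r| ≤ ρ∫_θ‖Dv‖` — the linear
term of the identity is negligible. [folklore] -/
theorem firstModeIBP :
    ∀ (g g' : ℝ → ℂ), (∀ θ ∈ Icc 0 (2 * Real.pi), HasDerivAt g (g' θ) θ) →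
      ContinuousOn g' (Icc 0 (2 * Real.pi)) → g 0 = g (2 * Real.pi) →
      ‖∫ θ in (0 : ℝ)..2 * Real.pi, g θ * Complex.exp (-((θ : ℂ) * Complex.I))‖ ≤
        ∫ θ in (0 : ℝ)..2 * Real.pi, ‖g' θ‖ :=
  fun _ _ hg hg' hper => firstModeIBP_of hg hg' hper

/-- **(M3b) SECOND FOURIER MODE BY PARTS**, working form: for `g ∈ C¹([0,2π]; ℂ)` with `g 0 = g 2π`,
`‖∫_0^{2π} g(θ) e^{−2iθ} dθ‖ ≤ ½∫_0^{2π} ‖g′‖` (`e^{−2iθ}dθ = d(ie^{−2iθ}/2)`). [folklore] -/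
theorem secondModeIBP_of {g g' : ℝ → ℂ} (hg : ∀ θ ∈ Icc 0 (2 * π), HasDerivAt g (g' θ) θ)
    (hg' : ContinuousOn g' (Icc 0 (2 * π))) (hper : g 0 = g (2 * π)) :
    ‖∫ θ in (0 : ℝ)..2 * π, g θ * Complex.exp (-(2 * (θ : ℂ) * Complex.I))‖ ≤
      (1 / 2) * ∫ θ in (0 : ℝ)..2 * π, ‖g' θ‖ := by
  have hvper : Complex.I / 2 * Complex.exp (-(2 * ((0 : ℝ) : ℂ) * Complex.I)) =
      Complex.I / 2 * Complex.exp (-(2 * ((2 * π : ℝ) : ℂ) * Complex.I)) := by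
    rw [show -(2 * ((2 * π : ℝ) : ℂ) * Complex.I) = ((-2 : ℤ) : ℂ) * (2 * π * Complex.I) by push_cast; ring,
      Complex.exp_int_mul_two_pi_mul_I]
    simp
  have hvn : ∀ θ : ℝ, ‖Complex.I / 2 * Complex.exp (-(2 * (θ : ℂ) * Complex.I))‖ = 1 / 2 := fun θ => by
    rw [norm_mul, norm_div, Complex.norm_I, norm_exp_neg_two_mul_I, mul_one]
    simp
  have he : Continuous fun θ : ℝ => Complex.exp (-(2 * (θ : ℂ) * Complex.I)) := by fun_prop
  exact norm_integral_mul_le_of_periodic_primitive hg hg' hper hasDerivAt_I_half_mul_exp_neg_two he hvper hvn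

/-- **(M3b) `NsregP2.R47.SecondModeIBP`, binder-for-binder** (Sketch47 of nsreg-p2 g37, plate t50-M3b).  Use in
ROUND-47: `∫_θ (v_r² − v_θ²) = Re ∫ (v e^{−iθ})²`, the swirl/strain quadrupole of the identity. [folklore] -/
theorem secondModeIBP :
    ∀ (g g' : ℝ → ℂ), (∀ θ ∈ Icc 0 (2 * Real.pi), HasDerivAt g (g' θ) θ) →
      ContinuousOn g' (Icc 0 (2 * Real.pi)) → g 0 = g (2 * Real.pi) →
      ‖∫ θ in (0 : ℝ)..2 * Real.pi, g θ * Complex.exp (-(2 * (θ : ℂ) * Complex.I))‖ ≤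
        (1 / 2) * ∫ θ in (0 : ℝ)..2 * Real.pi, ‖g' θ‖ :=
  fun _ _ hg hg' hper => secondModeIBP_of hg hg' hper

/-! ## (M3c) Sup-Poincaré on the circle -/

/-- **Going round the circle the shorter way**: for `g ∈ C¹([0,2π]; ℂ)` with `g 0 = g 2π` and
`0 ≤ s ≤ u ≤ 2π`: `2‖g u − g s‖ ≤ ∫_0^{2π} ‖g′‖` (`g u − g s = ∫_s^u g′ = −∫_u^{2π} g′ − ∫_0^s g′`). [folklore] -/
theorem two_mul_norm_sub_le_integral_norm {g g' : ℝ → ℂ} (hg : ∀ θ ∈ Icc 0 (2 * π), HasDerivAt g (g' θ) θ)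
    (hg' : ContinuousOn g' (Icc 0 (2 * π))) (hper : g 0 = g (2 * π)) {s u : ℝ} (hs : 0 ≤ s) (hsu : s ≤ u)
    (hu : u ≤ 2 * π) :
    2 * ‖g u - g s‖ ≤ ∫ t in (0 : ℝ)..2 * π, ‖g' t‖ := by
  have hn : ContinuousOn (fun t => ‖g' t‖) (Icc 0 (2 * π)) := hg'.norm
  -- integrability and FTC on the three arcs
  have harc : ∀ {a b : ℝ}, 0 ≤ a → a ≤ b → b ≤ 2 * π →
      IntervalIntegrable g' volume a b ∧ IntervalIntegrable (fun t => ‖g' t‖) volume a b ∧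
        ∫ t in a..b, g' t = g b - g a := fun {a b} ha hab hb => by
    have hsub : uIcc a b ⊆ Icc 0 (2 * π) := by rw [uIcc_of_le hab]; exact Icc_subset_Icc ha hb
    have hi : IntervalIntegrable g' volume a b := (hg'.mono hsub).intervalIntegrable
    exact ⟨hi, (hn.mono hsub).intervalIntegrable,
      intervalIntegral.integral_eq_sub_of_hasDerivAt (fun t ht => hg t (hsub ht)) hi⟩
  obtain ⟨_, hn1, hf1⟩ := harc le_rfl hs (hsu.trans hu)
  obtain ⟨_, hn2, hf2⟩ := harc hs hsu hu
  obtain ⟨_, hn3, hf3⟩ := harc (hs.trans hsu) hu le_rfl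
  have hadd12 := intervalIntegral.integral_add_adjacent_intervals hn1 hn2
  have hadd := intervalIntegral.integral_add_adjacent_intervals (hn1.trans hn2) hn3
  -- the short way
  have hshort : ‖g u - g s‖ ≤ ∫ t in s..u, ‖g' t‖ := by
    rw [← hf2]; exact intervalIntegral.norm_integral_le_integral_norm hsu
  -- the long way
  have hlong : ‖g u - g s‖ ≤ (∫ t in (0 : ℝ)..s, ‖g' t‖) + ∫ t in u..2 * π, ‖g' t‖ := by
    have hid : g u - g s = -(∫ t in u..2 * π, g' t) - ∫ t in (0 : ℝ)..s, g' t := by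
      rw [hf3, hf1, hper]; ring
    rw [hid]
    calc ‖-(∫ t in u..2 * π, g' t) - ∫ t in (0 : ℝ)..s, g' t‖
        ≤ ‖-(∫ t in u..2 * π, g' t)‖ + ‖∫ t in (0 : ℝ)..s, g' t‖ := norm_sub_le _ _
      _ ≤ (∫ t in u..2 * π, ‖g' t‖) + ∫ t in (0 : ℝ)..s, ‖g' t‖ := by
          rw [norm_neg]
          exact add_le_add (intervalIntegral.norm_integral_le_integral_norm hu)
            (intervalIntegral.norm_integral_le_integral_norm hs)
      _ = _ := add_comm _ _
  linarith [hshort, hlong, hadd12, hadd]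

/-- **(M3c) SUP-POINCARÉ ON THE CIRCLE**, working form: for `g ∈ C¹([0,2π]; ℂ)` with `g 0 = g 2π` and
`θ ∈ [0,2π]`: `‖g θ − (2π)⁻¹∫_0^{2π} g‖ ≤ ½ ∫_0^{2π} ‖g′‖` (pointwise `‖g θ − g t‖ ≤ ½∫‖g′‖` by the previous lemma,
then average in `t`). [folklore] -/
theorem circleSupPoincare_of {g g' : ℝ → ℂ} (hg : ∀ θ ∈ Icc 0 (2 * π), HasDerivAt g (g' θ) θ)
    (hg' : ContinuousOn g' (Icc 0 (2 * π))) (hper : g 0 = g (2 * π)) {θ : ℝ} (hθ : θ ∈ Icc 0 (2 * π)) :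
    ‖g θ - ((2 * Real.pi)⁻¹ : ℝ) • ∫ t in (0 : ℝ)..2 * Real.pi, g t‖ ≤
      (1 / 2) * ∫ t in (0 : ℝ)..2 * Real.pi, ‖g' t‖ := by
  set L := ∫ t in (0 : ℝ)..2 * π, ‖g' t‖ with hL
  have hπ : 0 < 2 * π := by positivity
  have hI : uIcc 0 (2 * π) = Icc 0 (2 * π) := uIcc_of_le hπ.le
  have hgc : ContinuousOn g (Icc 0 (2 * π)) := fun t ht => (hg t ht).continuousAt.continuousWithinAt
  have hgi : IntervalIntegrable g volume 0 (2 * π) := (hgc.mono hI.le).intervalIntegrable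
  -- pointwise bound in the second variable
  have hpt : ∀ t ∈ Ι 0 (2 * π), ‖g θ - g t‖ ≤ L / 2 := by
    intro t ht
    rw [uIoc_of_le hπ.le] at ht
    rcases le_total t θ with h | h
    · have := two_mul_norm_sub_le_integral_norm hg hg' hper ht.1.le h hθ.2
      linarith
    · have := two_mul_norm_sub_le_integral_norm hg hg' hper hθ.1 h ht.2
      rw [norm_sub_rev] at this
      linarith
  -- rewrite the deviation from the mean as a mean of differences
  have hid : g θ - ((2 * π)⁻¹ : ℝ) • ∫ t in (0 : ℝ)..2 * π, g t =
      ((2 * π)⁻¹ : ℝ) • ∫ t in (0 : ℝ)..2 * π, (g θ - g t) := by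
    rw [intervalIntegral.integral_sub intervalIntegrable_const hgi, intervalIntegral.integral_const, smul_sub,
      smul_smul, sub_zero, inv_mul_cancel₀ hπ.ne', one_smul]
  rw [hid, norm_smul, Real.norm_eq_abs, abs_of_pos (inv_pos.2 hπ)]
  have hbound := intervalIntegral.norm_integral_le_of_norm_le_const (a := 0) (b := 2 * π)
    (f := fun t => g θ - g t) (C := L / 2) hpt
  rw [sub_zero, abs_of_pos hπ] at hbound
  calc (2 * π)⁻¹ * ‖∫ t in (0 : ℝ)..2 * π, (g θ - g t)‖ ≤ (2 * π)⁻¹ * (L / 2 * (2 * π)) :=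
        mul_le_mul_of_nonneg_left hbound (inv_nonneg.2 hπ.le)
    _ = (1 / 2) * L := by field_simp

/-- **(M3c) `NsregP2.R47.CircleSupPoincare`, binder-for-binder** (Sketch47 of nsreg-p2 g37, plate t50-M3c).  Hence
`∫‖g − ⨍g‖² ≤ π²∫‖g′‖²` for the fluctuation of the slice velocity on each circle (the sharp Wirtinger constant is not
needed in ROUND-47). [folklore] -/
theorem circleSupPoincare :
    ∀ (g g' : ℝ → ℂ), (∀ θ ∈ Icc 0 (2 * Real.pi), HasDerivAt g (g' θ) θ) →
      ContinuousOn g' (Icc 0 (2 * Real.pi)) → g 0 = g (2 * Real.pi) →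
      ∀ θ ∈ Icc 0 (2 * Real.pi),
        ‖g θ - ((2 * Real.pi)⁻¹ : ℝ) • ∫ t in (0 : ℝ)..2 * Real.pi, g t‖ ≤
          (1 / 2) * ∫ t in (0 : ℝ)..2 * Real.pi, ‖g' t‖ :=
  fun _ _ hg hg' hper _ hθ => circleSupPoincare_of hg hg' hper hθ

end Summit.NavierStokesRegularity.NavierStokesRegularity.Theorems.PowerGaugeEulerLiouville.Condenser

end
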